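import Summits.QuantumFields.BalabanUV.Beta.CompositeVertexWardRootedTwoLetter
import Summits.QuantumFields.BalabanUV.Beta.CompositeMixedWardGradedSym
import Summits.QuantumFields.BalabanUV.Beta.SymBorderWardSiteLaw

/-!
# `BalabanUV.Beta.CompositeVertexWardSymTwoBricks` — row D1 ∕ (C1), PART 117: THE (W)_j BORDER LETTER FOR THE (0.4)-SYMMETRISED COMPOSITE TABLES — PART 106b∕c's
# rooted second-order border Ward law TWINNED token for token for an1's sym bricks `symLinKerAt ∕ symVhKerAt ∕ symVh2KerSymAt (toSite (r k)) L` (root list; the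
# record's `compB r L m` is the constant list): the third window law `symVh2KerSymAt_window_dz`, the kernel law `compVH2Ker_div_mid_sym`, the packed bond Ward law
# `divV_atw_compVh2S_sym_eq_conjV` (remainder ZERO), and the letters `hBord_compB_sym ∕ hBord''_compB_sym` (PART 106c's generic lift) — every depth

HONEST DEPENDENCY (page 1, mandatory): continuum YM on T⁴ ⇐ BetaPertH ∧ nine spine estimates (0/9 proved); BetaPertH ⇐ (D1) ∧ (D4) ∧ CAP+tail;
G-an2-4 gates asym, D1 and NE2/3/4.  HONEST FRAMING (cell contract, verbatim): «discharging `BetaPertH` makes Bałaban's UV stability UNCONDITIONAL —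
a real constructive-QFT result; it is NOT the continuum limit and NOT the Clay problem.»  ABSOLUTE RULE (cell charter, verbatim): «No internally-minted
statement may enter as a cited fact. Every hypothesis is either kernel-proved in this package or a verbatim quotation of a PUBLISHED theorem with page
reference. The manuscript(s) under audit are NOT citable for their own disputed steps — they are the thing under adjudication; programme-internal
(2001/route/tribunal) claims are never citable.»

WHY (an2 gen 87; memo `gen87/HWD-INVENTORY-87.md` §2: for the record's SYM tables the only (W)_j letter not in the tree was the border letter at depth ≥ 2, because the sym
`vh2` brick's third window law had not been typed).  an1's site-level sym border Ward law `SymBorderWardSiteLaw.symVh2KerAt_siteWard` is in the tree (the ½-symmetrisation of the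
two single-assignment laws); PART 110d typed the first two sym window laws `symLinKerAt_window_dz` ∕ `symVhKerAt_window_dz`.  THIS FILE is PART 106b §2–§3 + PART 106c §3 with
`(linKerAt, vhKerAt, vh2KerAt, vh2KerSymAt) ↦ (symLinKerAt, symVhKerAt, symVh2KerAt, symVh2KerSymAt)` and the sym support letters `symVh2Tab_eq_zero₂ ∕ ₃` — proofs verbatim.
With it the (W)_j letters of PART 115 are tree theorems for the sym graded tables too; what the sym record then displays is the (S)-law alone (PART 118).

WHAT: [folklore] finite ∕ `tsum` bookkeeping BY NAME; no `def`, no `def … : Prop`, nothing cited, 0 sorry.  Nothing of Bałaban's asserted, valued or discharged; 0 estimates;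
0∕4 row-D1 binders; (W)_j NOT claimed at any record; NOT (C1), NOT D1, NEVER «G-an2-4 closed», NOT BetaPertH, NOT continuum, NOT Clay.  an2 gen 87, 2026-08-30.  No existing file touched.
-/

noncomputable section

open Finset
open scoped BigOperators
open Literature.MathematicalPhysics.QuantumFieldTheory.Balaban1983to89
open Literature.MathematicalPhysics.QuantumFieldTheory.Balaban1983to89.Beta
open AffineAveraging (Site box toSite unitVec)
open AveragingHessianKernels (Bond Near)
open Summit.QuantumFields.BalabanUV.Beta.SymAveragingHessianCounts (symLinKerAt symVhKerAt)
open Summit.QuantumFields.BalabanUV.Beta.SymAveragingMixedJetTables (symVh2KerAt symVh2Tab_eq_zero₂ symVh2Tab_eq_zero₃)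
open Summit.QuantumFields.BalabanUV.Beta.CompositeVertexKernelRec
open Summit.QuantumFields.BalabanUV.Beta.LinearGaugeVH (nearBox mem_nearBox)
open Summit.QuantumFields.BalabanUV.Beta.CompositeVertexKernelBoundsTwoSym (symVh2KerSymAt symVh2KerSymAt_apply symVh2KerSymAt_swap)
open Summit.QuantumFields.BalabanUV.Beta.SymBorderWardSiteLaw (symVh2KerAt_siteWard)
open Summit.QuantumFields.BalabanUV.Beta.CompositeVertexWardRooted (sum_offs_eq_sum_nearBox)
open Summit.QuantumFields.BalabanUV.Beta.CompositeMixedWardGradedSym (symLinKerAt_window_dz symVhKerAt_window_dz)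
open Summit.QuantumFields.BalabanUV.Beta.CompositeVertexWardRootedTwo (compVH2Ker_div_mid)
open Summit.QuantumFields.BalabanUV.Beta.CompositeVertexWardRootedTwoLetter (compVH2Ker_swap hBord_of_bondLaw hBord''_of_bondLaw)
open AveragingHessianKernels (packVH packVH_inl_inr packVH_inr_inl packVH_inl_inl packVH_inr_inr eq_smul_blk_of_off_eq_zero)
open AveragingContours (off blk)
open AveragingWardStencils (b6UnitVec_eq)
open KernelWard (divV)
open ExpKernelCalculus (comp)
open Summit.QuantumFields.BalabanUV.Beta.ChartConjugation (conjV)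
open Summit.QuantumFields.BalabanUV.Beta.BorderedHessian (diagK conjV_diagK_apply)
open Summit.QuantumFields.BalabanUV.Beta.AveragingWardRootedStencils (legInd legInd_inl legInd_inr)
open Summit.QuantumFields.BalabanUV.Beta.SecondOrderSocketIdentification (atw)

namespace Summit.QuantumFields.BalabanUV.Beta.CompositeVertexWardSymTwoBricks

variable {d : ℕ}

/-! ## §1 an1's (0.4)-SYMMETRISED bricks with the slot-symmetrised second-order brick `symVh2KerSymAt` obey the third window law -/

section Sym

variable {L : ℕ} {r : Fin (d + 1) → ℕ}

/-- [folklore] support of the slot-symmetrised sym second-order brick in its middle slot (an1 `symVh2Tab_eq_zero₂ ∕ ₃`). -/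
theorem symVh2KerSymAt_eq_zero_mid (hr : r ∈ box (d + 1) L) (μ : Fin (d + 1)) (y : Site (d + 1)) (f b' : Bond (d + 1)) {κ : Fin (d + 1)}
    {x : Site (d + 1)} (hx : ¬ Near L y x) : symVh2KerSymAt (toSite r) L μ y f (κ, x) b' = 0 := by
  have h1 : symVh2KerAt (toSite r) L μ y f (κ, x) b' = 0 := by
    unfold symVh2KerAt; rw [symVh2Tab_eq_zero₂ hr μ y f (g := (κ, x)) hx b']; push_cast; rfl
  have h2 : symVh2KerAt (toSite r) L μ y f b' (κ, x) = 0 := by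
    unfold symVh2KerAt; rw [symVh2Tab_eq_zero₃ hr μ y f b' (h' := (κ, x)) hx]; push_cast; rfl
  rw [symVh2KerSymAt_apply, h1, h2, add_zero, mul_zero]

/-- [folklore] an1's slot-symmetrised site law (`SymBorderWardSiteLaw.symVh2KerAt_siteWard`) in the letters of `symVh2KerSymAt`, pointwise: the middle-slot divergence of the
slot-symmetrised second-order brick is the first-order brick times the jump between the root and the fluctuation leg's site. -/
theorem symVh2KerSymAt_div_mid (hL : 1 ≤ L) (ρ : Site (d + 1)) (μ : Fin (d + 1)) (y u : Site (d + 1)) (f b' : Bond (d + 1)) :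
    ∑ κ : Fin (d + 1), (symVh2KerSymAt ρ L μ y f (κ, u - unitVec κ) b' - symVh2KerSymAt ρ L μ y f (κ, u) b') =
      symVhKerAt ρ L μ y f b' * ((if u = (L : ℤ) • y + ρ then (1 : ℝ) else 0) - (if u = f.2 then (1 : ℝ) else 0)) := by
  simp only [symVh2KerSymAt_apply]
  exact symVh2KerAt_siteWard (show L ≠ 0 by omega) ρ μ y u f b'

/-- [folklore] **THE WINDOW MIDDLE-SLOT LAW OF THE SLOT-SYMMETRISED SYM SECOND-ORDER BRICK** (`h𝓋₂W` for `symVh2KerSymAt (toSite r) L`, box root, `1 ≤ L`), for ANY coarse weight `G`: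
`Σ_κ Σ_{e ∈ offs} symVh2KerSymAt f (κ, L•y+e) b′ · (G (L•y+e+e_κ) − G (L•y+e)) = (G (L•y+ρ) − G f.2) · symVhKerAt f b′` — `symVh2KerSymAt_div_mid` summed by parts over `ℤ^{d+1}`. -/
theorem symVh2KerSymAt_window_dz (hL : 1 ≤ L) (hr : r ∈ box (d + 1) L) (μ : Fin (d + 1)) (y : Site (d + 1)) (f b' : Bond (d + 1)) (G : Site (d + 1) → ℝ) :
    ∑ κ : Fin (d + 1), ∑ e ∈ offs L, symVh2KerSymAt (toSite r) L μ y f (κ, (L : ℤ) • y + e) b' * (G ((L : ℤ) • y + e + unitVec κ) - G ((L : ℤ) • y + e)) =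
      (G ((L : ℤ) • y + toSite r) - G f.2) * symVhKerAt (toSite r) L μ y f b' := by
  classical
  have hsupp : ∀ (κ : Fin (d + 1)) (x : Site (d + 1)), x ∉ nearBox L y → symVh2KerSymAt (toSite r) L μ y f (κ, x) b' = 0 :=
    fun κ x hx => symVh2KerSymAt_eq_zero_mid hr μ y f b' (fun h => hx (mem_nearBox.2 h))
  have hsupp' : ∀ (κ : Fin (d + 1)) (x : Site (d + 1)), x ∉ (nearBox L y).image (fun x' => x' + unitVec κ) →
      symVh2KerSymAt (toSite r) L μ y f (κ, x - unitVec κ) b' = 0 := by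
    intro κ x hx
    apply hsupp κ (x - unitVec κ)
    intro hmem
    exact hx (Finset.mem_image.2 ⟨x - unitVec κ, hmem, sub_add_cancel x (unitVec κ)⟩)
  have hs1 : ∀ κ : Fin (d + 1), Summable fun x : Site (d + 1) => symVh2KerSymAt (toSite r) L μ y f (κ, x - unitVec κ) b' * G x :=
    fun κ => summable_of_ne_finset_zero (s := (nearBox L y).image (fun x' => x' + unitVec κ)) fun x hx => by rw [hsupp' κ x hx, zero_mul]
  have hs2 : ∀ κ : Fin (d + 1), Summable fun x : Site (d + 1) => symVh2KerSymAt (toSite r) L μ y f (κ, x) b' * G x :=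
    fun κ => summable_of_ne_finset_zero (s := nearBox L y) fun x hx => by rw [hsupp κ x hx, zero_mul]
  have hs3 : ∀ κ : Fin (d + 1), Summable fun x : Site (d + 1) =>
      (symVh2KerSymAt (toSite r) L μ y f (κ, x - unitVec κ) b' - symVh2KerSymAt (toSite r) L μ y f (κ, x) b') * G x :=
    fun κ => ((hs1 κ).sub (hs2 κ)).congr fun x => by ring
  have key : ∀ κ : Fin (d + 1), ∑ e ∈ offs L, symVh2KerSymAt (toSite r) L μ y f (κ, (L : ℤ) • y + e) b' * (G ((L : ℤ) • y + e + unitVec κ) - G ((L : ℤ) • y + e)) =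
      ∑' x : Site (d + 1), (symVh2KerSymAt (toSite r) L μ y f (κ, x - unitVec κ) b' - symVh2KerSymAt (toSite r) L μ y f (κ, x) b') * G x := by
    intro κ
    have hA : ∑' x : Site (d + 1), symVh2KerSymAt (toSite r) L μ y f (κ, x - unitVec κ) b' * G x =
        ∑ e ∈ offs L, symVh2KerSymAt (toSite r) L μ y f (κ, (L : ℤ) • y + e) b' * G ((L : ℤ) • y + e + unitVec κ) := by
      rw [← (Equiv.addRight (unitVec κ)).tsum_eq (fun x : Site (d + 1) => symVh2KerSymAt (toSite r) L μ y f (κ, x - unitVec κ) b' * G x)]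
      simp only [Equiv.coe_addRight, add_sub_cancel_right]
      rw [tsum_eq_sum (s := nearBox L y) (fun x hx => by rw [hsupp κ x hx, zero_mul])]
      exact (sum_offs_eq_sum_nearBox y (fun x => symVh2KerSymAt (toSite r) L μ y f (κ, x) b' * G (x + unitVec κ))).symm
    have hB : ∑' x : Site (d + 1), symVh2KerSymAt (toSite r) L μ y f (κ, x) b' * G x =
        ∑ e ∈ offs L, symVh2KerSymAt (toSite r) L μ y f (κ, (L : ℤ) • y + e) b' * G ((L : ℤ) • y + e) := by
      rw [tsum_eq_sum (s := nearBox L y) (fun x hx => by rw [hsupp κ x hx, zero_mul])]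
      exact (sum_offs_eq_sum_nearBox y (fun x => symVh2KerSymAt (toSite r) L μ y f (κ, x) b' * G x)).symm
    calc ∑ e ∈ offs L, symVh2KerSymAt (toSite r) L μ y f (κ, (L : ℤ) • y + e) b' * (G ((L : ℤ) • y + e + unitVec κ) - G ((L : ℤ) • y + e))
        = ∑ e ∈ offs L, symVh2KerSymAt (toSite r) L μ y f (κ, (L : ℤ) • y + e) b' * G ((L : ℤ) • y + e + unitVec κ) -
            ∑ e ∈ offs L, symVh2KerSymAt (toSite r) L μ y f (κ, (L : ℤ) • y + e) b' * G ((L : ℤ) • y + e) := by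
          simp only [mul_sub, Finset.sum_sub_distrib]
      _ = ∑' x : Site (d + 1), symVh2KerSymAt (toSite r) L μ y f (κ, x - unitVec κ) b' * G x -
            ∑' x : Site (d + 1), symVh2KerSymAt (toSite r) L μ y f (κ, x) b' * G x := by rw [hA, hB]
      _ = ∑' x : Site (d + 1), (symVh2KerSymAt (toSite r) L μ y f (κ, x - unitVec κ) b' * G x - symVh2KerSymAt (toSite r) L μ y f (κ, x) b' * G x) :=
          ((hs1 κ).tsum_sub (hs2 κ)).symm
      _ = _ := tsum_congr fun x => by ring
  have hsP : Summable fun x : Site (d + 1) => (if x = (L : ℤ) • y + toSite r then (1 : ℝ) else 0) * (symVhKerAt (toSite r) L μ y f b' * G x) :=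
    summable_of_ne_finset_zero (s := {(L : ℤ) • y + toSite r}) fun x hx => by
      rw [Finset.mem_singleton] at hx; rw [if_neg hx, zero_mul]
  have hsQ : Summable fun x : Site (d + 1) => (if x = f.2 then (1 : ℝ) else 0) * (symVhKerAt (toSite r) L μ y f b' * G x) :=
    summable_of_ne_finset_zero (s := {f.2}) fun x hx => by
      rw [Finset.mem_singleton] at hx; rw [if_neg hx, zero_mul]
  calc ∑ κ : Fin (d + 1), ∑ e ∈ offs L, symVh2KerSymAt (toSite r) L μ y f (κ, (L : ℤ) • y + e) b' * (G ((L : ℤ) • y + e + unitVec κ) - G ((L : ℤ) • y + e))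
      = ∑ κ : Fin (d + 1), ∑' x : Site (d + 1), (symVh2KerSymAt (toSite r) L μ y f (κ, x - unitVec κ) b' - symVh2KerSymAt (toSite r) L μ y f (κ, x) b') * G x :=
        Finset.sum_congr rfl fun κ _ => key κ
    _ = ∑' x : Site (d + 1), ∑ κ : Fin (d + 1), (symVh2KerSymAt (toSite r) L μ y f (κ, x - unitVec κ) b' - symVh2KerSymAt (toSite r) L μ y f (κ, x) b') * G x :=
        (Summable.tsum_finsetSum fun κ _ => hs3 κ).symm
    _ = ∑' x : Site (d + 1), symVhKerAt (toSite r) L μ y f b' * ((if x = (L : ℤ) • y + toSite r then (1 : ℝ) else 0) - (if x = f.2 then (1 : ℝ) else 0)) * G x := by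
        refine tsum_congr fun x => ?_
        rw [← Finset.sum_mul, symVh2KerSymAt_div_mid hL (toSite r) μ y x f b']
    _ = (∑' x : Site (d + 1), (if x = (L : ℤ) • y + toSite r then (1 : ℝ) else 0) * (symVhKerAt (toSite r) L μ y f b' * G x)) -
          ∑' x : Site (d + 1), (if x = f.2 then (1 : ℝ) else 0) * (symVhKerAt (toSite r) L μ y f b' * G x) := by
        rw [← hsP.tsum_sub hsQ]
        exact tsum_congr fun x => by ring
    _ = (G ((L : ℤ) • y + toSite r) - G f.2) * symVhKerAt (toSite r) L μ y f b' := by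
        rw [tsum_eq_single ((L : ℤ) • y + toSite r) (fun x hx => by rw [if_neg hx, zero_mul]),
          tsum_eq_single f.2 (fun x hx => by rw [if_neg hx, zero_mul]), if_pos rfl, if_pos rfl]
        ring

/-- [folklore] **THE COMPOSITE ROOTED SECOND-ORDER BORDER WARD LAW, KERNEL LEVEL** (an1's bricks `linKerAt ∕ vhKerAt ∕ symVh2KerSymAt (toSite (r k)) L`, in-block roots, `1 ≤ L`;
every depth `m`): the middle-slot background divergence of an2's top-peeled composite second-order border kernel is the composite first-order vertex kernel times the leg jump
at the composed root `R m = Σ_{k<m} L^k • toSite (r k)`. -/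
theorem compVH2Ker_div_mid_sym (hL : 1 ≤ L) {r : ℕ → Fin (d + 1) → ℕ} (hr : ∀ k, r k ∈ box (d + 1) L) (m : ℕ) (μ : Fin (d + 1)) (y : Site (d + 1))
    (f b' : Bond (d + 1)) (z : Site (d + 1)) :
    ∑ κ : Fin (d + 1),
        (compVH2Ker (fun k => symLinKerAt (toSite (r k)) L) (fun k => symVhKerAt (toSite (r k)) L) (fun k => symVh2KerSymAt (toSite (r k)) L) L m μ y f (κ, z - unitVec κ) b' -
          compVH2Ker (fun k => symLinKerAt (toSite (r k)) L) (fun k => symVhKerAt (toSite (r k)) L) (fun k => symVh2KerSymAt (toSite (r k)) L) L m μ y f (κ, z) b') =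
      ((if ((L ^ m : ℕ) : ℤ) • y + ∑ k ∈ Finset.range m, ((L ^ k : ℕ) : ℤ) • toSite (r k) = z then (1 : ℝ) else 0) - (if f.2 = z then (1 : ℝ) else 0)) *
        compVHKer (fun k => symLinKerAt (toSite (r k)) L) (fun k => symVhKerAt (toSite (r k)) L) L m μ y f b' :=
  compVH2Ker_div_mid (ρ := fun k => toSite (r k)) (R := fun m => ∑ k ∈ Finset.range m, ((L ^ k : ℕ) : ℤ) • toSite (r k))
    (by simp) (fun m => by rw [Finset.sum_range_succ]) (fun k μ y G => symLinKerAt_window_dz hL (hr k) μ y G)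
    (fun k μ y f G => symVhKerAt_window_dz hL (hr k) μ y f G) (fun k μ y f b' G => symVh2KerSymAt_window_dz hL (hr k) μ y f b' G) m μ y f b' z

end Sym

/-! ## §2 Packed: the anti-twin packed SYM composite second-order border table's bond Ward law (remainder zero) -/

section Packed

variable {L : ℕ} {r : ℕ → Fin (d + 1) → ℕ}

/-- [folklore] **THE BOND WARD LAW OF THE SYM COMPOSITE SECOND-ORDER BORDER TABLE** (anti-twin packed = the record's `compB` at the constant root list, F5c's `compVh2S` over
`(symLinKerAt, symVhKerAt, symVh2KerSymAt) ∘ r`, in-block roots, `1 ≤ L`; every depth `m`, every second background bond `(κ′, u′)`, every varied site `u₀`):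
`divV (κ u ↦ atw (compVh2S … m κ u κ′ u′)) u₀ = conjV (compVhS … m κ′ u′) (diagK (legInd (R m) u₀))`, `R m = Σ_{k<m} L^k • toSite (r k)` — remainder ZERO, as at j = 0
(`divV_symVh₂SAn1_fst_eq_conjV`).  Four fibre blocks: ff ∕ mm vanish on both sides; fm is §2's kernel law at the block root of `z`; mf is its anti-twin mirror at `x`. -/
theorem divV_atw_compVh2S_sym_eq_conjV (hL : 1 ≤ L) (hr : ∀ k, r k ∈ box (d + 1) L) (m : ℕ) (κ' : Fin (d + 1)) (u' u₀ : Site (d + 1)) :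
    divV (fun κ u => atw (compVh2S (fun k => symLinKerAt (toSite (r k)) L) (fun k => symVhKerAt (toSite (r k)) L) (fun k => symVh2KerSymAt (toSite (r k)) L) L m κ u κ' u')) u₀ =
      conjV (compVhS (fun k => symLinKerAt (toSite (r k)) L) (fun k => symVhKerAt (toSite (r k)) L) L m κ' u')
        (diagK (legInd (∑ k ∈ Finset.range m, ((L ^ k : ℕ) : ℤ) • toSite (r k)) u₀)) := by
  have hLm : 1 ≤ L ^ m := Nat.one_le_pow m L hL
  funext x z a b
  rw [conjV_diagK_apply]
  rcases a with β | m₀ <;> rcases b with β' | μ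
  · -- (inl, inl): both sides vanish
    simp only [KernelWard.divV, Finset.sum_apply, Pi.sub_apply, atw, sub_self, Finset.sum_const_zero, compVhS, packVH_inl_inl, zero_mul]
  · -- (inl β, inr μ): the kernel law at the block root of `z`
    simp only [KernelWard.divV, Finset.sum_apply, Pi.sub_apply, atw, compVh2S, compVhS, packVH_inl_inr, legInd_inl, legInd_inr, b6UnitVec_eq]
    by_cases hz : off (L ^ m) z = 0
    · simp only [hz, if_true]
      rw [compVH2Ker_div_mid_sym hL hr m μ (blk (L ^ m) z) (β, x) (κ', u') u₀, ← eq_smul_blk_of_off_eq_zero hLm hz]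
      ring
    · simp [hz]
  · -- (inr m₀, inl β'): the anti-twin mirror at `x`
    simp only [KernelWard.divV, Finset.sum_apply, Pi.sub_apply, atw, compVh2S, compVhS, packVH_inl_inr, packVH_inr_inl, legInd_inl, legInd_inr, b6UnitVec_eq]
    by_cases hx : off (L ^ m) x = 0
    · simp only [hx, if_true]
      have h := compVH2Ker_div_mid_sym hL hr m m₀ (blk (L ^ m) x) (β', z) (κ', u') u₀
      rw [← eq_smul_blk_of_off_eq_zero hLm hx, Finset.sum_sub_distrib] at h
      rw [Finset.sum_sub_distrib, Finset.sum_neg_distrib, Finset.sum_neg_distrib]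
      linear_combination (-1 : ℝ) * h
    · simp [hx]
  · -- (inr, inr): both sides vanish
    simp only [KernelWard.divV, Finset.sum_apply, Pi.sub_apply, atw, sub_self, Finset.sum_const_zero, compVhS, packVH_inr_inr, zero_mul]

end Packed

/-! ## §3 The two border letters for the sym composite tables at blocking `L^m`, remainder zero (PART 106c's generic lift) -/

section Letters

variable {L : ℕ} {r : ℕ → Fin (d + 1) → ℕ}

/-- [folklore] slot symmetry of the anti-twin packed sym composite second-order border table (`compVH2Ker_swap` at `symVh2KerSymAt_swap`). -/
theorem atw_compVh2S_sym_swap (m : ℕ) (κ : Fin (d + 1)) (u : Site (d + 1)) (κ' : Fin (d + 1)) (u' : Site (d + 1)) :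
    atw (compVh2S (fun k => symLinKerAt (toSite (r k)) L) (fun k => symVhKerAt (toSite (r k)) L) (fun k => symVh2KerSymAt (toSite (r k)) L) L m κ u κ' u') =
      atw (compVh2S (fun k => symLinKerAt (toSite (r k)) L) (fun k => symVhKerAt (toSite (r k)) L) (fun k => symVh2KerSymAt (toSite (r k)) L) L m κ' u' κ u) := by
  have hs := compVH2Ker_swap (ℓ := fun k => symLinKerAt (toSite (r k)) L) (𝓋 := fun k => symVhKerAt (toSite (r k)) L)
    (𝓋₂ := fun k => symVh2KerSymAt (toSite (r k)) L) (L := L) (fun k μ y g g₁ g₂ => (symVh2KerSymAt_swap (toSite (r k)) L μ y g g₁ g₂).symm)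
  funext x z a b
  rcases a with β | m₀ <;> rcases b with β' | μ
  · rfl
  · simp only [atw, compVh2S, packVH_inl_inr, hs m μ (blk (L ^ m) z) (β, x) (κ, u) (κ', u')]
  · simp only [atw, compVh2S, packVH_inl_inr, hs m m₀ (blk (L ^ m) x) (β', z) (κ, u) (κ', u')]
  · rfl

/-- [folklore] **`hBordˢ` — THE (W)_j BORDER LETTER FOR THE SYM COMPOSITE TABLES, FIRST SLOT, REMAINDER ZERO** (root list `r`, in the block, `1 ≤ L`; any depth `m`, block
lattice `L^m`, generator root `Σ_{k<m} L^k • toSite (r k)`, lock `cH·cB = ξ·cVH`) — g29's ∕ PART 115's `hBord` with `RB := 0`. -/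
theorem hBord_compB_sym (hL : 1 ≤ L) (hr : ∀ k, r k ∈ box (d + 1) L) (m : ℕ) {cH cB cVH ξ : ℝ} (hlock : cH * cB = ξ * cVH)
    (Y : Site (d + 1)) (κ' : Fin (d + 1)) (u' : Site (d + 1)) :
    cH • ∑ v ∈ box (d + 1) (L ^ m), divV (fun κ u => cB • atw (compVh2S (fun k => symLinKerAt (toSite (r k)) L) (fun k => symVhKerAt (toSite (r k)) L)
        (fun k => symVh2KerSymAt (toSite (r k)) L) L m κ u κ' u')) (((L ^ m : ℕ) : ℤ) • Y + toSite v) =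
      comp (cVH • compVhS (fun k => symLinKerAt (toSite (r k)) L) (fun k => symVhKerAt (toSite (r k)) L) L m κ' u')
          (diagK (ξ • ∑ v ∈ box (d + 1) (L ^ m), legInd (∑ k ∈ Finset.range m, ((L ^ k : ℕ) : ℤ) • toSite (r k)) (((L ^ m : ℕ) : ℤ) • Y + toSite v))) -
        comp (diagK (ξ • ∑ v ∈ box (d + 1) (L ^ m), legInd (∑ k ∈ Finset.range m, ((L ^ k : ℕ) : ℤ) • toSite (r k)) (((L ^ m : ℕ) : ℤ) • Y + toSite v)))
          (cVH • compVhS (fun k => symLinKerAt (toSite (r k)) L) (fun k => symVhKerAt (toSite (r k)) L) L m κ' u') :=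
  hBord_of_bondLaw _ (fun κ' u' u₀ => divV_atw_compVh2S_sym_eq_conjV hL hr m κ' u' u₀) hlock Y κ' u'

/-- [folklore] **`hBord''ˢ` — THE SAME IN THE SECOND SLOT.** -/
theorem hBord''_compB_sym (hL : 1 ≤ L) (hr : ∀ k, r k ∈ box (d + 1) L) (m : ℕ) {cH cB cVH ξ : ℝ} (hlock : cH * cB = ξ * cVH)
    (Y : Site (d + 1)) (κ : Fin (d + 1)) (u : Site (d + 1)) :
    cH • ∑ v ∈ box (d + 1) (L ^ m), divV (fun κ' u' => cB • atw (compVh2S (fun k => symLinKerAt (toSite (r k)) L) (fun k => symVhKerAt (toSite (r k)) L)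
        (fun k => symVh2KerSymAt (toSite (r k)) L) L m κ u κ' u')) (((L ^ m : ℕ) : ℤ) • Y + toSite v) =
      comp (cVH • compVhS (fun k => symLinKerAt (toSite (r k)) L) (fun k => symVhKerAt (toSite (r k)) L) L m κ u)
          (diagK (ξ • ∑ v ∈ box (d + 1) (L ^ m), legInd (∑ k ∈ Finset.range m, ((L ^ k : ℕ) : ℤ) • toSite (r k)) (((L ^ m : ℕ) : ℤ) • Y + toSite v))) -
        comp (diagK (ξ • ∑ v ∈ box (d + 1) (L ^ m), legInd (∑ k ∈ Finset.range m, ((L ^ k : ℕ) : ℤ) • toSite (r k)) (((L ^ m : ℕ) : ℤ) • Y + toSite v)))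
          (cVH • compVhS (fun k => symLinKerAt (toSite (r k)) L) (fun k => symVhKerAt (toSite (r k)) L) L m κ u) :=
  hBord''_of_bondLaw _ (fun κ' u' u₀ => divV_atw_compVh2S_sym_eq_conjV hL hr m κ' u' u₀) (fun κ u κ' u' => atw_compVh2S_sym_swap m κ u κ' u') hlock Y κ u

end Letters

end Summit.QuantumFields.BalabanUV.Beta.CompositeVertexWardSymTwoBricks

end
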